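import Literature.IUT.HodgeTheaters.Labels
import Literature.IUT.HodgeTheaters.LabelsPlusMinusTorsors
import HarnessLib

/-!
# Proofs over [IUTchI] Def 6.1 (i): the group theory of `𝔽_l^±`-groups and `𝔽_l^±`-torsors used by Props 6.6, 6.8

Mochizuki, *Inter-universal Teichmüller theory I*, §6, kurims manuscript (May 2020): Definition 6.1 (i)
p. 155, Proposition 6.6 (i)–(iii) p. 165, Proposition 6.8 (i) pp. 167–168. PROOF-ONLY companion
(theorems, no definitions) to `LabelsPlusMinusTorsors.lean` (abc-iut-L5-t4), written by the L5
discharge seat abc-iut-L5-t13. It isolates the pure `𝔽_l^{⋊±} = 𝔽_l ⋊ {±1}` combinatorics that the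
printed "torsor" assertions of Props 6.6/6.8 reduce to at the level of the index sets `T`:

* `FlPM.card_eq`, `FlPM.card_stabilizer`: `|𝔽_l^{⋊±}| = 2l`; the stabilizer in `𝔽_l^{⋊±}` of any
  `z ∈ 𝔽_l` has order two ("acts doubly transitively [i.e., transitively with stabilizers of order
  two]", Prop 6.8 (i) p. 168).
* `FlPMTorsor.exists_mulEquiv_autPM` (+ `read_conj`): for an `𝔽_l^±`-torsor `T` and `2 < l`, every
  chart `e` of the orbit reads `Aut_±(T)` isomorphically onto `𝔽_l^{⋊±}`, and changing the chart
  conjugates the reading — i.e. `Aut_±(T)` is "a finite group that is equipped with a natural outer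
  isomorphism to `𝔽_l^{⋊±}`" (Prop 6.6 (ii) p. 165, Prop 6.8 (i) p. 168).
* `FlPMTorsor.autPlus_isTorsor`, `autPM_isPretransitive`, `card_stabilizer_autPM`, `card_autPM`,
  `card_autPlus`: `Aut_+(T)` acts simply transitively, `Aut_±(T)` transitively with stabilizers of
  order two, `|Aut_±(T)| = 2l`, `|Aut_+(T)| = l`.
* `FlPMTorsor.isIso_iff_exists`, `exists_isIso`, `existsUnique_autPM_comp`, `card_isIso`: the
  isomorphisms `T ⥲ T'` of `𝔽_l^±`-torsors (bijections carrying the orbit of charts of `T'` into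
  that of `T`) form a torsor under `Aut_±(T)`, hence a set of cardinality `2l` ("maps bijectively …
  to the set of isomorphisms of `𝔽_l^±`-torsors between the index sets", Prop 6.6 (ii)).
* `FlPMGroup.isIso_iff_exists`, `exists_isIso`, `card_isIso`: the isomorphisms of `𝔽_l^±`-groups
  `E ⥲ E'` form a `{±1}`-torsor — exactly two of them for `2 < l` (Prop 6.6 (i), (iii) p. 165).

Hypotheses `2 < l` are exactly as in `LabelsPlusMinusTorsors.lean` (in IUT `l ≥ 5` is prime,
[IUTchI] Def 3.1 (c)). Record only; [claim: Mochizuki2012, status: disputed]; nothing here takes a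
side on any disputed step, and typed ≠ discharged for the bridge-level statements themselves.
-/

namespace Literature.IUT.HodgeTheaters

/-! ### `𝔽_l^{⋊±}`: cardinality, transitivity, stabilizers of order two -/

namespace FlPM

variable {l : ℕ}

/-- `|𝔽_l^{⋊±}| = 2l` ([IUTchI] Def 6.1 (i), p. 155). [claim: Mochizuki2012, status: disputed] -/
theorem card_eq (l : ℕ) : Nat.card (FlPM l) = 2 * l := by
  rw [Nat.card_congr SemidirectProduct.equivProd, Nat.card_prod, Nat.card_congr Multiplicative.toAdd,
    Nat.card_zmod, Nat.card_eq_fintype_card, Fintype.card_units_int, mul_comm]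

/-- `(λ, ε) ∈ 𝔽_l^{⋊±}` fixes `z ∈ 𝔽_l` iff `λ = z − ε z`. [claim: Mochizuki2012, status: disputed] -/
theorem smul_eq_self_iff (g : FlPM l) (z : ZMod l) : g • z = z ↔ g.left.toAdd = z - g.right • z := by
  rw [smul_def, add_comm]
  exact ⟨fun h => eq_sub_of_add_eq h, fun h => by rw [h, sub_add_cancel]⟩

/-- `𝔽_l^{⋊±}` acts transitively on `𝔽_l` (already the translations do).
[claim: Mochizuki2012, status: disputed] -/
theorem exists_smul_eq (z w : ZMod l) : ∃ g : FlPM l, g • z = w :=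
  ⟨transl (w - z), by rw [transl_smul]; abel⟩

/-- The stabilizer of `z ∈ 𝔽_l` in `𝔽_l^{⋊±}` is `{(z − εz, ε) | ε = ±1}`: it has order two — the
"stabilizers of order two" of [IUTchI] Prop 6.8 (i), p. 168, at the level of `𝔽_l^{⋊±} ↷ 𝔽_l`.
[claim: Mochizuki2012, status: disputed] -/
theorem card_stabilizer (z : ZMod l) : Nat.card (MulAction.stabilizer (FlPM l) z) = 2 := by
  rw [← Fintype.card_units_int, ← Nat.card_eq_fintype_card]
  refine Nat.card_congr
    { toFun := fun g => g.1.right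
      invFun := fun ε => ⟨mk (z - ε • z) ε, by
        rw [MulAction.mem_stabilizer_iff, mk_smul, add_comm, sub_add_cancel]⟩
      left_inv := fun g => by
        obtain ⟨g, hg⟩ := g
        rw [MulAction.mem_stabilizer_iff, smul_eq_self_iff] at hg
        exact Subtype.ext (SemidirectProduct.ext (by rw [mk_left, ← hg, ofAdd_toAdd]) rfl)
      right_inv := fun ε => rfl }

end FlPM

/-! ### `𝔽_l^±`-torsors: `Aut_±(T) ≅ 𝔽_l^{⋊±}` via charts, transitivity, stabilizers -/

namespace FlPMTorsor

variable {l : ℕ} {T : Type*} (S : FlPMTorsor l T)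

/-- For `2 < l`, the element of `𝔽_l^{⋊±}` through which `σ ∈ Aut_±(T)` reads in a chart `e` of the
orbit is unique (the action of `𝔽_l^{⋊±}` on `𝔽_l` is faithful). [claim: Mochizuki2012, status: disputed] -/
theorem existsUnique_read (hl : 2 < l) {e : T ≃ ZMod l} (he : e ∈ S.charts) {σ : Equiv.Perm T}
    (hσ : σ ∈ S.autPM) : ∃! g : FlPM l, ∀ t, e (σ t) = g • e t := by
  obtain ⟨g, hg⟩ := hσ e he
  refine ⟨g, hg, fun g' hg' => FlPM.toPerm_injective hl ?_⟩
  ext z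
  have h := hg' (e.symm z)
  rw [hg (e.symm z), Equiv.apply_symm_apply] at h
  rw [FlPM.toPerm_apply, FlPM.toPerm_apply]
  exact h.symm

/-- Changing the chart by `g ∈ 𝔽_l^{⋊±}` conjugates the reading of `σ ∈ Aut_±(T)` by `g`: the chart
isomorphisms `Aut_±(T) ⥲ 𝔽_l^{⋊±}` form a single **outer** isomorphism ("a finite group that is
equipped with a natural outer isomorphism to `𝔽_l^{⋊±}`", [IUTchI] Prop 6.6 (ii) p. 165, Prop 6.8 (i)
p. 168). [claim: Mochizuki2012, status: disputed] -/
theorem read_conj {e : T ≃ ZMod l} (g h : FlPM l) {σ : Equiv.Perm T} (hσ : ∀ t, e (σ t) = h • e t)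
    (t : T) : (e.trans (FlPM.toPerm l g)) (σ t) = (g * h * g⁻¹) • (e.trans (FlPM.toPerm l g)) t := by
  simp only [Equiv.trans_apply, FlPM.toPerm_apply, hσ t, mul_smul, inv_smul_smul]

/-- For `2 < l`, every chart `e` of an `𝔽_l^±`-torsor `T` reads `Aut_±(T)` ISOMORPHICALLY onto
`𝔽_l^{⋊±}`: `Aut_±(T)` "is" `𝔽_l^{⋊±}` up to the conjugation of `read_conj` ([IUTchI] Def 6.1 (i)
p. 155; Prop 6.6 (ii) p. 165). [claim: Mochizuki2012, status: disputed] -/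
theorem exists_mulEquiv_autPM (hl : 2 < l) {e : T ≃ ZMod l} (he : e ∈ S.charts) :
    ∃ φ : S.autPM ≃* FlPM l, ∀ (σ : S.autPM) (t : T), e (σ.1 t) = φ σ • e t := by
  choose f hf using fun σ : S.autPM => S.existsUnique_read hl he σ.2
  have mem : ∀ g : FlPM l, e.trans ((FlPM.toPerm l g).trans e.symm) ∈ S.autPM := fun g =>
    (S.mem_autPM_iff_exists _).mpr ⟨e, he, g, fun t => by simp⟩
  refine ⟨{ toFun := f, invFun := fun g => ⟨_, mem g⟩, left_inv := fun σ => ?_,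
            right_inv := fun g => ((hf ⟨_, mem g⟩).2 g fun t => by simp).symm,
            map_mul' := fun σ τ => ?_ }, fun σ t => (hf σ).1 t⟩
  · apply Subtype.ext
    ext t
    simp only [Equiv.trans_apply, FlPM.toPerm_apply, ← (hf σ).1 t, Equiv.symm_apply_apply]
  · symm
    refine (hf (σ * τ)).2 _ fun t => ?_
    rw [Subgroup.coe_mul, Equiv.Perm.coe_mul, Function.comp_apply, (hf σ).1, (hf τ).1, mul_smul]

/-- `Aut_+(T)` acts SIMPLY TRANSITIVELY on `T` (it is the group of translations read in any chart).
[claim: Mochizuki2012, status: disputed] -/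
theorem autPlus_isTorsor : IsTorsor S.autPlus T := by
  obtain ⟨e, he⟩ := S.nonempty
  refine ⟨fun s t => ⟨S.translChart he (e t - e s), ?_, ?_⟩⟩
  · change (S.translChart he (e t - e s)).1 s = t
    rw [translChart_apply, add_sub_cancel, Equiv.symm_apply_apply]
  · intro σ hσ
    change σ.1 s = t at hσ
    obtain ⟨c, hc⟩ := σ.2 e he
    have hcs := hc s
    rw [hσ] at hcs
    apply Subtype.ext
    ext x
    apply e.injective
    rw [hc x, translChart_apply, Equiv.apply_symm_apply, hcs]
    abel

/-- `Aut_±(T)` acts transitively on `T` ([IUTchI] Prop 6.8 (i), p. 168: "acts doubly transitively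
[i.e., transitively …]"). [claim: Mochizuki2012, status: disputed] -/
theorem autPM_isPretransitive : MulAction.IsPretransitive S.autPM T :=
  ⟨fun s t => by
    obtain ⟨σ, hσ, -⟩ := S.autPlus_isTorsor.existsUnique_smul_eq s t
    exact ⟨⟨σ.1, S.autPlus_le_autPM σ.2⟩, hσ⟩⟩

/-- "[… with stabilizers of order two]" ([IUTchI] Prop 6.8 (i), p. 168): for `2 < l` the stabilizer
in `Aut_±(T)` of any `t ∈ T` has exactly two elements (the identity and the reflection about `t`).
[claim: Mochizuki2012, status: disputed] -/
theorem card_stabilizer_autPM (hl : 2 < l) (t : T) :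
    Nat.card (MulAction.stabilizer S.autPM t) = 2 := by
  obtain ⟨e, he⟩ := S.nonempty
  obtain ⟨φ, hφ⟩ := S.exists_mulEquiv_autPM hl he
  rw [← FlPM.card_stabilizer (e t)]
  refine Nat.card_congr (φ.toEquiv.subtypeEquiv fun σ => ?_)
  rw [MulAction.mem_stabilizer_iff, MulAction.mem_stabilizer_iff]
  change σ.1 t = t ↔ φ σ • e t = e t
  rw [← hφ σ t, e.apply_eq_iff_eq]

/-- `|Aut_±(T)| = |𝔽_l^{⋊±}| = 2l` for `2 < l`. [claim: Mochizuki2012, status: disputed] -/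
theorem card_autPM (hl : 2 < l) : Nat.card S.autPM = 2 * l := by
  obtain ⟨φ, -⟩ := S.exists_mulEquiv_autPM hl S.nonempty.some_mem
  rw [Nat.card_congr φ.toEquiv, FlPM.card_eq]

/-- `|Aut_+(T)| = |𝔽_l| = l`. [claim: Mochizuki2012, status: disputed] -/
theorem card_autPlus : Nat.card S.autPlus = l := by
  rw [Nat.card_congr (S.shiftEquiv S.nonempty.some_mem), Nat.card_zmod]

/-! ### Isomorphisms of `𝔽_l^±`-torsors: a torsor under `Aut_±(T)` (Prop 6.6 (ii)) -/

section Iso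

variable {T' : Type*} (S' : FlPMTorsor l T')

/-- A bijection `f : T ≃ T'` is an isomorphism of `𝔽_l^±`-torsors as soon as ONE chart of `T'` pulls
back to a chart of `T`; then every chart does. [claim: Mochizuki2012, status: disputed] -/
theorem isIso_iff_exists (f : T ≃ T') :
    (∀ e' ∈ S'.charts, f.trans e' ∈ S.charts) ↔ ∃ e' ∈ S'.charts, f.trans e' ∈ S.charts := by
  refine ⟨fun h => ⟨_, S'.nonempty.some_mem, h _ S'.nonempty.some_mem⟩, ?_⟩
  rintro ⟨e₀, he₀, hf⟩ e' he'
  obtain ⟨g, rfl⟩ := S'.exists_of_mem he₀ he'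
  rw [← Equiv.trans_assoc]
  exact S.trans_toPerm_mem hf g

/-- Any two `𝔽_l^±`-torsors are isomorphic. [claim: Mochizuki2012, status: disputed] -/
theorem exists_isIso : ∃ f : T ≃ T', ∀ e' ∈ S'.charts, f.trans e' ∈ S.charts := by
  obtain ⟨e, he⟩ := S.nonempty
  obtain ⟨e', he'⟩ := S'.nonempty
  refine ⟨e.trans e'.symm, (S.isIso_iff_exists S' _).mpr ⟨e', he', ?_⟩⟩
  rwa [Equiv.trans_assoc, Equiv.symm_trans_self, Equiv.trans_refl]

/-- Precomposing an isomorphism of `𝔽_l^±`-torsors with an element of `Aut_±(T)` gives an isomorphism.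
[claim: Mochizuki2012, status: disputed] -/
theorem isIso_autPM_comp {σ : Equiv.Perm T} (hσ : σ ∈ S.autPM) {f : T ≃ T'}
    (hf : ∀ e' ∈ S'.charts, f.trans e' ∈ S.charts) : ∀ e' ∈ S'.charts, (σ.trans f).trans e' ∈ S.charts := by
  intro e' he'
  obtain ⟨g, hg⟩ := hσ _ (hf e' he')
  have h : (σ.trans f).trans e' = (f.trans e').trans (FlPM.toPerm l g) := by
    ext t
    have hgt := hg t
    simp only [Equiv.trans_apply] at hgt
    simp only [Equiv.trans_apply, FlPM.toPerm_apply, hgt]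
  rw [h]
  exact S.trans_toPerm_mem (hf e' he') g

/-- **The isomorphisms of `𝔽_l^±`-torsors `T ⥲ T'` form a torsor under `Aut_±(T)`**: any two differ by
precomposition with a unique element of `Aut_±(T)` — the index-set content of [IUTchI] Prop 6.6 (ii),
p. 165 ("forms an `𝔽_l^{⋊±}`-torsor … maps bijectively … to the set of isomorphisms of `𝔽_l^±`-torsors
between the index sets"). [claim: Mochizuki2012, status: disputed] -/
theorem existsUnique_autPM_comp {f f' : T ≃ T'} (hf : ∀ e' ∈ S'.charts, f.trans e' ∈ S.charts)
    (hf' : ∀ e' ∈ S'.charts, f'.trans e' ∈ S.charts) :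
    ∃! σ : Equiv.Perm T, σ ∈ S.autPM ∧ σ.trans f' = f := by
  obtain ⟨e', he'⟩ := S'.nonempty
  refine ⟨f.trans f'.symm, ⟨?_, ?_⟩, ?_⟩
  · rw [S.mem_autPM_iff_exists]
    obtain ⟨g, hg⟩ := S.exists_of_mem (hf' e' he') (hf e' he')
    refine ⟨f'.trans e', hf' e' he', g, fun t => ?_⟩
    have h := congrArg (fun φ : T ≃ ZMod l => φ t) hg
    simpa using h
  · rw [Equiv.trans_assoc, Equiv.symm_trans_self, Equiv.trans_refl]
  · rintro σ ⟨-, rfl⟩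
    rw [Equiv.trans_assoc, Equiv.self_trans_symm, Equiv.trans_refl]

/-- Hence, for `2 < l`, there are exactly `2l = |𝔽_l^{⋊±}|` isomorphisms of `𝔽_l^±`-torsors `T ⥲ T'`
([IUTchI] Prop 6.6 (ii), p. 165). [claim: Mochizuki2012, status: disputed] -/
theorem card_isIso (hl : 2 < l) :
    Nat.card {f : T ≃ T' // ∀ e' ∈ S'.charts, f.trans e' ∈ S.charts} = 2 * l := by
  obtain ⟨f₀, hf₀⟩ := S.exists_isIso S'
  rw [← S.card_autPM hl]
  symm
  refine Nat.card_congr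
    { toFun := fun σ => ⟨σ.1.trans f₀, S.isIso_autPM_comp S' σ.2 hf₀⟩
      invFun := fun f => ⟨f.1.trans f₀.symm,
        ((S.existsUnique_autPM_comp S' f.2 hf₀).exists.choose_spec.1 |> fun h => by
          obtain ⟨σ, ⟨hσ, hσf⟩, -⟩ := S.existsUnique_autPM_comp S' f.2 hf₀
          rw [← hσf, Equiv.trans_assoc, Equiv.self_trans_symm, Equiv.trans_refl]
          exact hσ)⟩
      left_inv := fun σ => Subtype.ext (by
        simp only [Equiv.trans_assoc, Equiv.self_trans_symm, Equiv.trans_refl])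
      right_inv := fun f => Subtype.ext (by
        simp only [Equiv.trans_assoc, Equiv.symm_trans_self, Equiv.trans_refl]) }

end Iso

end FlPMTorsor

/-! ### Isomorphisms of `𝔽_l^±`-groups: a `{±1}`-torsor (Prop 6.6 (i), (iii)) -/

namespace FlPMGroup

variable {l : ℕ} {E : Type*} (S : FlPMGroup l E) {E' : Type*} (S' : FlPMGroup l E')

/-- A bijection `f : E ≃ E'` is an isomorphism of `𝔽_l^±`-groups as soon as ONE chart of `E'` pulls
back to a chart of `E`; then every chart does. [claim: Mochizuki2012, status: disputed] -/
theorem isIso_iff_exists (f : E ≃ E') :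
    (∀ e' ∈ S'.charts, f.trans e' ∈ S.charts) ↔ ∃ e' ∈ S'.charts, f.trans e' ∈ S.charts := by
  refine ⟨fun h => ⟨_, S'.nonempty.some_mem, h _ S'.nonempty.some_mem⟩, ?_⟩
  rintro ⟨e₀, he₀, hf⟩ e' he'
  obtain ⟨ε, rfl⟩ := S'.exists_sign_of_mem he₀ he'
  rw [← Equiv.trans_assoc]
  exact S.trans_signPerm_mem hf ε

/-- Any two `𝔽_l^±`-groups are isomorphic. [claim: Mochizuki2012, status: disputed] -/
theorem exists_isIso : ∃ f : E ≃ E', ∀ e' ∈ S'.charts, f.trans e' ∈ S.charts := by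
  obtain ⟨e, he⟩ := S.nonempty
  obtain ⟨e', he'⟩ := S'.nonempty
  refine ⟨e.trans e'.symm, (S.isIso_iff_exists S' _).mpr ⟨e', he', ?_⟩⟩
  rwa [Equiv.trans_assoc, Equiv.symm_trans_self, Equiv.trans_refl]

/-- An isomorphism of `𝔽_l^±`-groups is `e⁻¹ ∘ (± ·) ∘ e'`-shaped: given charts `e ∈` orbit of `E` and
`e' ∈` orbit of `E'`, it is `e.trans ((signPerm ε).trans e'.symm)` for a sign `ε`.
[claim: Mochizuki2012, status: disputed] -/
theorem isIso_iff_exists_sign {e : E ≃ ZMod l} (he : e ∈ S.charts) {e' : E' ≃ ZMod l}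
    (he' : e' ∈ S'.charts) (f : E ≃ E') :
    (∀ e'' ∈ S'.charts, f.trans e'' ∈ S.charts) ↔
      ∃ ε : ℤˣ, f = e.trans ((signPerm l ε).trans e'.symm) := by
  rw [S.isIso_iff_exists S']
  constructor
  · rintro ⟨e'', he'', hf⟩
    obtain ⟨η, rfl⟩ := S'.exists_sign_of_mem he' he''
    obtain ⟨ε, hε⟩ := S.exists_sign_of_mem he hf
    refine ⟨ε * η⁻¹, ?_⟩
    ext x
    have h := congrArg (fun φ : E ≃ ZMod l => φ x) hε
    simp only [Equiv.trans_apply, signPerm_apply] at h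
    simp only [Equiv.trans_apply, signPerm_apply]
    rw [Equiv.eq_symm_apply, mul_comm, mul_smul, ← h, inv_smul_smul]
  · rintro ⟨ε, rfl⟩
    refine ⟨e', he', ?_⟩
    have h : (e.trans ((signPerm l ε).trans e'.symm)).trans e' = e.trans (signPerm l ε) := by
      ext x; simp
    rw [h]
    exact S.trans_signPerm_mem he ε

/-- **The isomorphisms of `𝔽_l^±`-groups `E ⥲ E'` form a `{±1}`-torsor**: for `2 < l` there are
exactly two of them ([IUTchI] Prop 6.6 (i) "the first factor [`{±1}`] may be thought of as
corresponding to the induced isomorphisms of `𝔽_l^±`-groups between the index sets", (iii) "forms a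
`{±1}`-torsor … maps bijectively … to the set of isomorphisms of `𝔽_l^±`-groups", p. 165).
[claim: Mochizuki2012, status: disputed] -/
theorem card_isIso (hl : 2 < l) :
    Nat.card {f : E ≃ E' // ∀ e' ∈ S'.charts, f.trans e' ∈ S.charts} = 2 := by
  obtain ⟨e, he⟩ := S.nonempty
  obtain ⟨e', he'⟩ := S'.nonempty
  rw [← Fintype.card_units_int, ← Nat.card_eq_fintype_card]
  symm
  refine Nat.card_congr (Equiv.ofBijective
    (fun ε => ⟨e.trans ((signPerm l ε).trans e'.symm), (S.isIso_iff_exists_sign S' he he' _).mpr ⟨ε, rfl⟩⟩)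
    ⟨fun ε η h => ?_, fun f => ?_⟩)
  · have h1 := congrArg (fun φ : {f : E ≃ E' // ∀ e' ∈ S'.charts, f.trans e' ∈ S.charts} =>
      e' (φ.1 (e.symm 1))) h
    simp only [Equiv.trans_apply, Equiv.apply_symm_apply, signPerm_apply] at h1
    -- `ε • 1 = η • 1` in `𝔽_l` with `2 < l` forces `ε = η`
    rcases Int.units_eq_one_or ε with rfl | rfl <;> rcases Int.units_eq_one_or η with rfl | rfl
    · rfl
    · exfalso
      rw [one_smul, Units.smul_def, Units.val_neg, Units.val_one, neg_smul, one_smul] at h1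
      have h2 : ((2 : ℕ) : ZMod l) = 0 := by
        rw [Nat.cast_ofNat]
        calc (2 : ZMod l) = 1 + 1 := one_add_one_eq_two.symm
          _ = 1 + -1 := by nth_rw 2 [h1]
          _ = 0 := add_neg_cancel 1
      rw [ZMod.natCast_eq_zero_iff] at h2
      exact absurd (Nat.le_of_dvd two_pos h2) (not_le.mpr hl)
    · exfalso
      rw [one_smul, Units.smul_def, Units.val_neg, Units.val_one, neg_smul, one_smul] at h1
      have h2 : ((2 : ℕ) : ZMod l) = 0 := by
        rw [Nat.cast_ofNat]
        calc (2 : ZMod l) = 1 + 1 := one_add_one_eq_two.symm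
          _ = 1 + -1 := by nth_rw 2 [← h1]
          _ = 0 := add_neg_cancel 1
      rw [ZMod.natCast_eq_zero_iff] at h2
      exact absurd (Nat.le_of_dvd two_pos h2) (not_le.mpr hl)
    · rfl
  · obtain ⟨ε, hε⟩ := (S.isIso_iff_exists_sign S' he he' f.1).mp f.2
    exact ⟨ε, Subtype.ext hε.symm⟩

end FlPMGroup

end Literature.IUT.HodgeTheaters
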